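import Literature.Topology.FourManifolds.TautFoliationsSuspensionCollar
import HarnessLib

/-!
# Vanishing cycles of a `C⁰` codimension-one foliation (definition)

Sibling of `TautFoliationsSuspensionCollar.lean`. A **(weak, topological) vanishing cycle** of
the foliation `F` of `M` is a one-parameter family of loops `f_t : S¹ → M`, `t ∈ [0, ε)`, with

1. each `f_t` a loop *in a leaf* `A_t` (continuous in the leaf topology),
2. `f_0` **not** null-homotopic in its leaf `A_0`, while `f_t` is null-homotopic in `A_t` for
   every `0 < t < ε`,
3. for each `θ ∈ S¹` the curve `t ↦ f_t(θ)` **topologically transverse** to `F`: in a flow box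
   of the atlas around it, its transverse coordinate is an injective (equivalently, for a
   continuous curve, strictly monotone) function of `t`.

This is Novikov's notion (S. P. Novikov, *Topology of foliations*, Trudy Moskov. Mat. Obšč. 14
(1965), §5; Camacho–Lins Neto, *Geometric Theory of Foliations*, Ch. VII §1, Definition, with
the weak (`C⁰`, not necessarily immersed, not necessarily simple) requirements appropriate to
`C⁰` foliations — the first step of the proof of Novikov's compact leaf theorem produces exactly
such a family (Ch. VII §2, Prop. 1), the later steps improve it). We record it as a structure
`Foliation.VanishingCycle F` of data and proofs; `TautFoliationsSuspensionCollar.lean`'s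
`leafLoop` packages a leafwise loop as a path of the leaf space, in which the homotopy
conditions are stated.

* `Foliation.closedLeafPath` (**definition**): a closed leafwise curve `g : I → M` as a loop of
  the leaf space `F.LeafSpace`.
* `Foliation.VanishingCycle` (**definition**), with projections `loop`, `loop_zero_not_homotopic`,
  `loop_homotopic_refl`, `mem_leaf` (**proved**: each `f_t` runs in the leaf of `f_t(0)`).

[cite: CamachoLinsNeto1985, Ch. VII §1 Definition; Novikov1965, §5]
-/

noncomputable section

open Set Filter Function
open scoped Topology unitInterval

namespace Literature.Topology.FourManifolds

namespace Foliation

variable {B : Type*} [TopologicalSpace B] {M : Type*} [TopologicalSpace M] (F : Foliation B M)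

/-- A closed leafwise curve `g : I → M` (`g 1 = g 0`, continuous in the leaf topology) as a
loop of the leaf space at `g 0`. [folklore] -/
def closedLeafPath (g : I → M) (hg : Continuous (toLeafSpace ∘ g : I → F.LeafSpace)) (hcl : g 1 = g 0) :
    Path (toLeafSpace (g 0) : F.LeafSpace) (toLeafSpace (g 0)) where
  toFun := toLeafSpace ∘ g
  continuous_toFun := hg
  source' := rfl
  target' := congrArg toLeafSpace hcl

/-- The values of `closedLeafPath`. [folklore] -/
@[simp] theorem closedLeafPath_apply (g : I → M) (hg : Continuous (toLeafSpace ∘ g : I → F.LeafSpace))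
    (hcl : g 1 = g 0) (θ : I) : F.closedLeafPath g hg hcl θ = toLeafSpace (g θ) := rfl

/-- A **(weak) vanishing cycle** of the `C⁰` codimension-one foliation `F`: a family of leafwise
loops `fam t`, `t ∈ [0, ε)`, jointly continuous, with `fam 0` not null-homotopic in its leaf,
`fam t` null-homotopic in its leaf for `0 < t < ε`, and every curve `t ↦ fam t θ` topologically
transverse to `F` (injective transverse coordinate in a flow box of the atlas, locally in `t`).
[cite: CamachoLinsNeto1985, Ch. VII §1 Definition] -/
structure VanishingCycle where
  /-- The length of the parameter interval `[0, ε)`. -/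
  ε : ℝ
  /-- The parameter interval is non-degenerate. -/
  ε_pos : 0 < ε
  /-- The family of loops `fam t : I → M`, `t ∈ [0, ε)`. -/
  fam : ℝ → I → M
  /-- Joint continuity in `(t, θ)`. -/
  continuousOn : ContinuousOn (uncurry fam) (Ico 0 ε ×ˢ univ)
  /-- Each `fam t` is a closed curve. -/
  closed : ∀ t ∈ Ico 0 ε, fam t 1 = fam t 0
  /-- Each `fam t` is a leafwise curve (continuous in the leaf topology). -/
  leafwise : ∀ t ∈ Ico 0 ε, Continuous (toLeafSpace ∘ fam t : I → F.LeafSpace)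
  /-- `fam 0` is not null-homotopic in its leaf. -/
  not_homotopic_zero : ¬ (F.closedLeafPath (fam 0) (leafwise 0 ⟨le_rfl, ε_pos⟩)
    (closed 0 ⟨le_rfl, ε_pos⟩)).Homotopic (Path.refl _)
  /-- `fam t`, `0 < t < ε`, is null-homotopic in its leaf. -/
  homotopic_refl : ∀ (t : ℝ) (ht : t ∈ Ioo 0 ε), (F.closedLeafPath (fam t) (leafwise t ⟨ht.1.le, ht.2⟩)
    (closed t ⟨ht.1.le, ht.2⟩)).Homotopic (Path.refl _)
  /-- The curves `t ↦ fam t θ` are topologically transverse to `F`, locally in `t`. -/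
  transverse : ∀ (θ : I), ∀ t ∈ Ico 0 ε, ∃ e ∈ F.atlas, ∃ η > (0 : ℝ),
    (∀ s ∈ Ico 0 ε ∩ Ioo (t - η) (t + η), fam s θ ∈ e.source) ∧
    InjOn (fun s ↦ (e (fam s θ)).2) (Ico 0 ε ∩ Ioo (t - η) (t + η))

namespace VanishingCycle

variable {F} (C : F.VanishingCycle)

/-- The loop `f_t` of the vanishing cycle in the leaf space, `t ∈ [0, ε)`. [folklore] -/
def loop {t : ℝ} (ht : t ∈ Ico 0 C.ε) : Path (toLeafSpace (C.fam t 0) : F.LeafSpace) (toLeafSpace (C.fam t 0)) :=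
  F.closedLeafPath (C.fam t) (C.leafwise t ht) (C.closed t ht)

/-- The values of the loops. [folklore] -/
@[simp] theorem loop_apply {t : ℝ} (ht : t ∈ Ico 0 C.ε) (θ : I) : C.loop ht θ = toLeafSpace (C.fam t θ) := rfl

/-- `f_0` is not null-homotopic in its leaf. [folklore] -/
theorem loop_zero_not_homotopic : ¬ (C.loop ⟨le_rfl, C.ε_pos⟩).Homotopic (Path.refl _) :=
  C.not_homotopic_zero

/-- `f_t`, `0 < t < ε`, is null-homotopic in its leaf. [folklore] -/
theorem loop_homotopic_refl {t : ℝ} (ht : t ∈ Ioo 0 C.ε) : (C.loop ⟨ht.1.le, ht.2⟩).Homotopic (Path.refl _) :=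
  C.homotopic_refl t ht

/-- Each loop `f_t` runs in the leaf of `f_t 0`. [folklore] -/
theorem mem_leaf {t : ℝ} (ht : t ∈ Ico 0 C.ε) (θ : I) : C.fam t θ ∈ F.leaf (C.fam t 0) :=
  F.mem_leaf_of_continuous_toLeafSpace (C.leafwise t ht) 0 θ

/-- Each `f_t` is continuous. [folklore] -/
theorem continuous_fam {t : ℝ} (ht : t ∈ Ico 0 C.ε) : Continuous (C.fam t) := by
  have h : ContinuousOn (uncurry C.fam ∘ fun θ : I ↦ (t, θ)) univ :=
    C.continuousOn.comp (continuous_const.prodMk continuous_id).continuousOn fun θ _ ↦ ⟨ht, mem_univ θ⟩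
  exact continuousOn_univ.1 h

/-- Each transverse curve `t ↦ f_t θ` is continuous on `[0, ε)`. [folklore] -/
theorem continuousOn_transverse (θ : I) : ContinuousOn (fun t ↦ C.fam t θ) (Ico 0 C.ε) :=
  C.continuousOn.comp (continuous_id.prodMk continuous_const).continuousOn fun _ ht ↦ ⟨ht, mem_univ θ⟩

end VanishingCycle

end Foliation

end Literature.Topology.FourManifolds
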